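import Summits.AtomisticToContinuum.FouriersLaw.Theses.LatticeLandauDamping

/-!
# `LatticeLandauDamping.Assembly` — PROVED

Route `AtomisticToContinuum/FouriersLaw/LatticeLandauDamping`, assembly item
`stmt-AtomisticToContinuum-14379` (`Assembly`):

  `AbelGreenKubo → AbelThermodynamicLimit → NessUnique → FiniteResponseOfUnique → FouriersLaw`.

The route file carries the planner-authored, sorry-free D-0027 §2.1 deciding theorem
`Summit.AtomisticToContinuum.FouriersLaw.Theses.LatticeLandauDamping.closes` (re-pointed
2026-08-16 to consume the target `AbelGreenKubo`), whose type is literally the body of `Assembly`;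
this file records the item-closing theorem whose type is the route decl `Assembly` by name.
For the mathematics (clause (i) of `FouriersLawFor` from the in-tree fact
`pinnedChain_exists_isSteadyState` plus weak-NESS uniqueness `NessUnique`; clause (ii) from the
Abel–Green–Kubo witness upgraded by `AbelThermodynamicLimit`, with the finite-`N` responses of a
steady-state family supplied by `FiniteResponseOfUnique`) see the body of `closes` in the route
file.  No named-fact hypotheses: the theorem is unconditional (its axioms are those of `closes`:
`propext`, `Classical.choice`, `Quot.sound`).
-/

namespace Summit.AtomisticToContinuum.FouriersLaw.Theorems

/-- Settles `stmt-AtomisticToContinuum-14379` (assembly of route `LatticeLandauDamping`): the target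
`AbelGreenKubo`, the thermodynamic-limit bridge `AbelThermodynamicLimit`, weak steady-state
uniqueness `NessUnique` and existence of the finite-`N` response limits `FiniteResponseOfUnique`
imply the sub-problem statement `FouriersLaw`.  Proof: the route's deciding theorem `closes`
(after unfolding `Assembly`). [folklore] -/
theorem latticeLandauDamping_assembly_proof :
    Summit.AtomisticToContinuum.FouriersLaw.Theses.LatticeLandauDamping.Assembly := by
  unfold Summit.AtomisticToContinuum.FouriersLaw.Theses.LatticeLandauDamping.Assembly
  exact Summit.AtomisticToContinuum.FouriersLaw.Theses.LatticeLandauDamping.closes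

/-- Settles `stmt-AtomisticToContinuum-15011`, the assembly item of route `LatticeLandauDamping`
as RESTATED 2026-08-16 by the unused-crux repair (rev 12):

  `WindowDecomposition → NoDrudeWeight → PositiveDensity → AbelOfSpectralDensity →
   AbelThermodynamicLimit → NessUnique → FiniteResponseOfUnique → FouriersLaw`,

i.e. the three spectral cruxes (low-frequency window decomposition of the current spectral
measure, no Drude weight, positive density at frequency `0`), the proved Poisson-kernel lemma
`AbelOfSpectralDensity`, and the three bridge cruxes (Abelian thermodynamic limit in witness form,
weak steady-state uniqueness, existence of the finite-`N` response limits) imply the sub-problem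
statement `FouriersLaw` for the pinned anharmonic chain.  The body of `Assembly` is, by
construction of the route file, literally the type of the planner-authored deciding theorem
`Summit.AtomisticToContinuum.FouriersLaw.Theses.LatticeLandauDamping.closes` (which derives the
target `AbelGreenKubo` with `κ_A(T) = (T²)⁻¹·π·g(0)` from the spectral cruxes inside its proof and
then runs clauses (i)/(ii) of `FouriersLawFor`); so the proof is `closes` after unfolding.
Unconditional: no named-fact hypotheses; axioms `propext`, `Classical.choice`, `Quot.sound`.
(The earlier `latticeLandauDamping_assembly_proof` above closed the superseded 4-hypothesis
target form, item 14379; it keeps elaborating because `Assembly` and `closes` were restated in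
lockstep.) [folklore] -/
theorem latticeLandauDamping_assembly8_proof :
    Summit.AtomisticToContinuum.FouriersLaw.Theses.LatticeLandauDamping.Assembly := by
  unfold Summit.AtomisticToContinuum.FouriersLaw.Theses.LatticeLandauDamping.Assembly
  exact Summit.AtomisticToContinuum.FouriersLaw.Theses.LatticeLandauDamping.closes

end Summit.AtomisticToContinuum.FouriersLaw.Theorems
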